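import Literature.NumberTheory.EllipticCurves.HeegnerPoints
import Mathlib.NumberTheory.LegendreSymbol.JacobiSymbol
import HarnessLib

set_option linter.dupNamespace false -- `Summit.BirchSwinnertonDyer.BirchSwinnertonDyer.Theorems.…` (summit = sub)
set_option autoImplicit false

/-!
# Route `BiquadraticEisensteinDescent` — DEFINITIONS (D-0017 `Theorems/<RouteSlug><Topic>Defs.lean`, reviewed):
# the objects of the crux idea `sifted-variance-twist-census` (crux `HeegnerTwistCouplingInSupply`, stmt-BirchSwinnertonDyer-21381)

Cell `pub/bsd-wall`, width-prover seat `bsd-wall-cm-bed-w1` g19 (explicit-unit), route `BiquadraticEisensteinDescent`, crux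
stmt-BirchSwinnertonDyer-21381 `HeegnerTwistCouplingInSupply`; serves the crux idea card
`Cruxes/HeegnerTwistCouplingInSupply/Ideas/sifted-variance-twist-census.md` (cruxidea seat 2 g25, 2026-08-29) by typing its
objects in the `Theorems` tree VERBATIM from the card's sketch `Cruxes/HeegnerTwistCouplingInSupply/SketchIdeasSeat2G25b.lean`
(which is not importable from `Theorems`), so that the card's ★ glue `CensusOfMoments` can be PROVED in the companion file
`…HeegnerTwistCouplingInSupplySiftedVarianceCensus.lean`.

The card (rung-level, CELL-FREE census for the `j = 8000` corner; NOT a line for the crux): for the `√2`-corner curves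
`B_m : y² = x³ + 4m x² + 2m² x` (quadratic twist of `B₁` by `m`; for a prime `m = p ≡ 7 (16)` this is the crux's `W` with
`j = 8000`, additive and CM-inert at `p`, root number `−1`), average over the MODULUS `m` — running over SIFTED integers
`m ≤ Q` (squarefree, `m ≡ 7 (16)`, all prime factors `> Q^{1/8}`; primes are included by counting) — the Heegner-window first
moment `S m y = Σ_{d ∈ D(m,y)} |L(B_m^{(d)}, 1)|` over the window `y = (log₂ Q)³` and its square (`SiftedMoments`, the card's
analytic input K1 + K2, an X. Li-type mixed second moment — RESEARCH, not proved anywhere); Chebyshev then gives the census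
`CellFreeCensus`: all but `o(π(Q))` primes `p ≤ Q`, `p ≡ 7 (16)` have a Heegner `d`, `|d| ≤ (log₂ Q)³`, with `L(B_p^{(d)}, 1) ≠ 0`.

* `Bp m` — the Weierstrass model `⟨0, 4m, 0, 2m², 0⟩` of `B_m`;  `Lval m d = ‖L(B_m^{(d)}, 1)‖` through the tree's
  `WeierstrassCurve.quadraticTwist` and `WeierstrassCurve.entireLFunction` (as in the crux conclusion);
* `Dset m y` — the Heegner window: fundamental discriminants `d ∈ [−y, −7]` (i.e. `d = d_K` of an imaginary quadratic `K`,
  tree `IsImaginaryQuadratic`), `d ≡ 1 (8)`, `(d/q) = 1` for every prime `q ∣ m` (Mathlib `jacobiSym`);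
* `S m y` — the window first moment;  `window Q = (Nat.log 2 Q)³`;  `sifted Q` — the sifted moduli
  (`Nat.sqrt (Nat.sqrt (Nat.sqrt Q)) < q` for every prime `q ∣ m`, i.e. `Q < q⁸`);
* `SiftedMoments A` (K1 + K2), `CellFreeCensus` (the census), `CensusOfMoments := (∃ A > 0, SiftedMoments A) → CellFreeCensus`
  (the card's ★ glue, «S-sized» — PROVED unconditionally in the companion file).

DEFINITIONS ONLY (verbatim from the sketch, renamed into this namespace); no theorem, no named fact, no `sorry`, no instance,
no notation. Nothing here asserts anything about `L`-values, class numbers, the crux or BSD; BSD is not proved by any of this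
and stmt-21381 is not closed. Junk values (documented): `jacobiSym d q` at `q = 2` is Mathlib's extension (never met on
`sifted Q`, whose members are odd); `S m y / (A * #Dset m y)` is `0` when the window is empty (Lean's `x / 0 = 0`), so an
empty window counts as exceptional in the variance — harmless for the glue, which only bounds the census from above.

References: the card and sketch above; X. Li, *Moments of quadratic twists of modular L-functions*, Invent. Math. (2024) =
arXiv:2208.07343, Thm 1.1 (the unconditional second moment the card leans on); K. Soundararajan, M. P. Young, JEMS 12 (2010).
-/

noncomputable section

open scoped Classical

open Literature.NumberTheory.EllipticCurves

namespace Summit.BirchSwinnertonDyer.BirchSwinnertonDyer.Theorems.SiftedVarianceCensus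

/-- The `√2`-corner curve `B_m : y² = x³ + 4m x² + 2m² x` (the quadratic twist of `B₁ : y² = x³ + 4x² + 2x` by `m`; for a
prime `m = p ≡ 5, 7 (8)` this is the crux's `W` with `j = 8000`, CM by `ℤ[√−2]`, additive and CM-inert at `p`).
Card `sifted-variance-twist-census`, sketch `SketchIdeasSeat2G25b.lean` (verbatim). -/
def Bp (m : ℕ) : WeierstrassCurve ℚ := ⟨0, 4 * m, 0, 2 * m ^ 2, 0⟩

/-- `|L(B_m^{(d)}, 1)|` through the tree's entire `L`-function of the quadratic twist (exactly the quantity whose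
non-vanishing the crux `HeegnerTwistCouplingInSupply` asks for). Sketch `SketchIdeasSeat2G25b.lean` (verbatim). -/
def Lval (m : ℕ) (d : ℤ) : ℝ := ‖((Bp m).quadraticTwist (d : ℚ)).entireLFunction 1‖

/-- The Heegner window `D(m, y)`: fundamental discriminants `d ∈ [−y, −7]` (`d = d_K` for an imaginary quadratic field `K`)
with `d ≡ 1 (8)` and `(d/q) = 1` for every prime `q ∣ m` (for `m = p` an odd prime: `2` and `p` split in `ℚ(√d)`, the
Heegner hypothesis for `N(B_p) = 2^a p²`). Junk: Mathlib's `jacobiSym d 2` if `2 ∣ m` (never the case on `sifted Q`).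
Sketch `SketchIdeasSeat2G25b.lean` (verbatim). -/
def Dset (m y : ℕ) : Finset ℤ :=
  (Finset.Icc (-(y : ℤ)) (-7)).filter (fun d =>
    (∃ (K : Type) (_ : Field K) (_ : NumberField K), IsImaginaryQuadratic K ∧ NumberField.discr K = d) ∧
    d % 8 = 1 ∧ ∀ q : ℕ, q.Prime → q ∣ m → jacobiSym d q = 1)

/-- The Heegner-window first moment `S(m, y) = Σ_{d ∈ D(m,y)} |L(B_m^{(d)}, 1)|` for the modulus `m`.
Sketch `SketchIdeasSeat2G25b.lean` (verbatim). -/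
def S (m y : ℕ) : ℝ := ∑ d ∈ Dset m y, Lval m d

/-- The polylogarithmic window `y = (log₂ Q)³` (so that `h(d) ≤ √|d| log|d| < p` is automatic for `p > Q^{1/8}`).
Sketch `SketchIdeasSeat2G25b.lean` (verbatim). -/
def window (Q : ℕ) : ℕ := Nat.log 2 Q ^ 3

/-- The SIFTED moduli: `m ∈ [1, Q]`, `m ≡ 7 (16)` (the cell-less rank-one class of the `B_p` corner), squarefree, every
prime factor `q` with `Nat.sqrt (Nat.sqrt (Nat.sqrt Q)) < q` (equivalently `Q < q⁸`); it contains every prime `p ≡ 7 (16)`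
with `Q^{1/8} < p ≤ Q` and has `≪ Q / log Q` elements (proved in the companion file).
Sketch `SketchIdeasSeat2G25b.lean` (verbatim). -/
def sifted (Q : ℕ) : Finset ℕ :=
  (Finset.Icc 1 Q).filter (fun m => m % 16 = 7 ∧ Squarefree m ∧
    ∀ q : ℕ, q.Prime → q ∣ m → Nat.sqrt (Nat.sqrt (Nat.sqrt Q)) < q)

/-- ★ The card's ANALYTIC INPUT (K1 + K2): first and second moment of the NORMALISED window moment
`S m y / (A · #D(m,y))` over the sifted moduli, both with relative error `o(1)` (an Iwaniec/Shen first moment and a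
Soundararajan–Young / X. Li-type MIXED second moment, carried over the sieve-weighted two-parameter family `{χ_{m d}}`;
`A > 0` is the first-moment constant of `f_{B₁}`). RESEARCH — asserted nowhere in the tree; a `Prop` with a parameter,
used only as a hypothesis. Junk: an empty window contributes `0 / 0 = 0`. Sketch `SketchIdeasSeat2G25b.lean` (verbatim). -/
def SiftedMoments (A : ℝ) : Prop :=
  ∀ ε : ℝ, 0 < ε → ∃ Q₀ : ℕ, ∀ Q : ℕ, Q₀ ≤ Q →
    |∑ m ∈ sifted Q, (S m (window Q) / (A * (Dset m (window Q)).card) - 1)| ≤ ε * (sifted Q).card ∧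
    ∑ m ∈ sifted Q, (S m (window Q) / (A * (Dset m (window Q)).card)) ^ 2 ≤ (1 + ε) * (sifted Q).card

/-- The CENSUS (the card's output): for every `ε > 0` and all large `Q`, at most `ε Q / log Q` primes `p ≤ Q` with
`p ≡ 7 (16)` have `L(B_p^{(d)}, 1) = 0` for EVERY `d` of the Heegner window `D(p, (log₂ Q)³)` — i.e. all but `o(π(Q))` such
primes have a non-vanishing window twist (then `p ∤ h(d)` by size, cf. the tree's
`…ThreeSquaresPinCorner.classNumber_lt_of_natAbs_discr_lt_six_mul`, and the crux conclusion holds for `W = B_p`).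
A closed `Prop`, asserted nowhere. Sketch `SketchIdeasSeat2G25b.lean` (verbatim). -/
def CellFreeCensus : Prop :=
  ∀ ε : ℝ, 0 < ε → ∃ Q₀ : ℕ, ∀ Q : ℕ, Q₀ ≤ Q →
    ((((Finset.Icc 1 Q).filter (fun p => p.Prime ∧ p % 16 = 7 ∧
        ∀ d ∈ Dset p (window Q), Lval p d = 0)).card : ℝ)) ≤ ε * Q / Real.log Q

/-- ★ The card's GLUE («Chebyshev: an exceptional modulus contributes `(0 − 1)² = 1` to the variance
`Σ (S/M − 1)² = Σ (S/M)² − 2 Σ (S/M − 1) − #sifted ≤ 3ε · #sifted`, primes `> Q^{1/8}` lie in the sifted set,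
`#sifted ≪ Q / log Q`», S-sized): the moments imply the census. PROVED unconditionally in
`…HeegnerTwistCouplingInSupplySiftedVarianceCensus.lean` (`censusOfMoments`). Sketch `SketchIdeasSeat2G25b.lean` (verbatim). -/
def CensusOfMoments : Prop := (∃ A : ℝ, 0 < A ∧ SiftedMoments A) → CellFreeCensus

end Summit.BirchSwinnertonDyer.BirchSwinnertonDyer.Theorems.SiftedVarianceCensus

end
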